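import Summits.Ventures.CertifiedQuantumChemistry.Rows.SymmetryBlocks
import HarnessLib

/-!
# Ventures/CertifiedQuantumChemistry — Rows/SymmetryBlockWords.lean: word expansion and the block theorem (typer aside T-06b, part 2 of 3)

HONEST FRAMING (verbatim): certified bounds for a stated model Hamiltonian in a stated basis; not a
claim about the real molecule beyond that model.

Continues `Rows/SymmetryBlocks.lean`: the expansion `P_b e_t = Σ_w Pcoef_b w t • e_{Pimg w t}` (`P4_single`), the
block matrix entry `blockMat_cast`, absorption of the (commuting) generators by `P_b` (`P4_act*`, `pstep*_P4`,
`zform_P4_left : Q(P_b u, P_b v) = 16 Q(u, P_b v)`), word images `P4_single_img`, and the BLOCK THEOREM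
`block_nonneg`: a passing `ddCheckP` of the block matrix on the live orbit representatives proves
`Q(P_b x, P_b x) ≥ 0`. 0 `sorry`. Typer `pub-qchem-typer` (gen 3), 0 core-h.
-/

namespace Summit.Ventures.CertifiedQuantumChemistry

open Matrix Finset
open Summit.HubbardSuperconductivity.HubbardSuperconductivity.Theorems.CooperPairDMottWalk

namespace SymmetryBlocks

open SgnMap

variable {ι : Type*} [Fintype ι] [DecidableEq ι] {g : Fin 4 → SgnMap ι} {B : ι → ι → ℤ}

/-! ### The word expansion of `P_b e_t` -/

/-- One projector step on a weighted basis vector, as a sum over the letter `w ∈ Bool`. -/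
theorem pstep_single_bool {g1 : SgnMap ι} (hg : g1.isInvol = true) (b : Bool) (c : ℝ) (t : ι) :
    pstep g1 (sgnR b) (c • Pi.single t (1 : ℝ)) =
      ∑ w : Bool, (c * (ccoef g1 (sgnZ b) w t : ℝ)) • Pi.single (cimg g1 w t) (1 : ℝ) := by
  rw [Fintype.sum_bool, pstep_single hg, add_comm]
  simp only [ccoef, cimg, cond_true, cond_false, Int.cast_one, mul_one, Int.cast_mul, sgnR_eq_cast]
  congr 1
  ring_nf

/-- `P_b e_t = Σ_w Pcoef_b w t • e_{Pimg w t}`. -/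
theorem P4_single (hg : ∀ i, (g i).isInvol = true) (b0 b1 b2 b3 : Bool) (t : ι) :
    P4 g b0 b1 b2 b3 (Pi.single t 1) =
      ∑ w3 : Bool, ∑ w2 : Bool, ∑ w1 : Bool, ∑ w0 : Bool,
        ((Pcoef g b0 b1 b2 b3 w0 w1 w2 w3 t : ℤ) : ℝ) • Pi.single (Pimg g w0 w1 w2 w3 t) (1 : ℝ) := by
  have e0 : (Pi.single t (1 : ℝ)) = (1 : ℝ) • Pi.single t (1 : ℝ) := (one_smul _ _).symm
  rw [P4, e0, pstep_single_bool (hg 3)]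
  simp only [pstep_sum, pstep_single_bool (hg 2), pstep_single_bool (hg 1),
    pstep_single_bool (hg 0)]
  refine Finset.sum_congr rfl fun w3 _ => Finset.sum_congr rfl fun w2 _ =>
    Finset.sum_congr rfl fun w1 _ => Finset.sum_congr rfl fun w0 _ => ?_
  simp only [Pcoef, Pimg, Int.cast_mul, one_mul]

/-- The block matrix entry is `16 Q(e_{r k}, P_b e_{r l})`. -/
theorem blockMat_cast (hg : ∀ i, (g i).isInvol = true) (b0 b1 b2 b3 : Bool) {d : ℕ} (r : Fin d → ι)
    (k l : Fin d) :
    ((blockMat g B b0 b1 b2 b3 r k l : ℤ) : ℝ) =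
      16 * zform B (Pi.single (r k) 1) (P4 g b0 b1 b2 b3 (Pi.single (r l) 1)) := by
  rw [P4_single hg, blockMat, wsum_eq]
  simp only [map_sum, map_smul, zform_single, smul_eq_mul]
  push_cast
  rfl

/-- Apply `g` (`b = true`) or nothing. -/
noncomputable def bact (g1 : SgnMap ι) (b : Bool) (y : ι → ℝ) : ι → ℝ := bif b then g1.act y else y

/-- The sign picked up by `P_b` under `bact`: `bif w then s else 1`. -/
noncomputable def bsgn (w : Bool) (s : ℝ) : ℝ := bif w then s else 1

/-- `bsgn` is the cast of an integer sign. -/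
theorem bsgn_eq_cast (w b : Bool) : bsgn w (sgnR b) = ((bif w then sgnZ b else 1 : ℤ) : ℝ) := by
  cases w <;> simp [bsgn, sgnR_eq_cast]

/-! ### `P_b` absorbs the generators -/

section Absorb

variable (hg : ∀ i, (g i).isInvol = true) (hc : ∀ i j, (g i).comm (g j) = true) (b0 b1 b2 b3 : Bool)
include hg hc

/-- `P_b (g₀ y) = s₀ P_b y`. -/
theorem P4_act0 (y : ι → ℝ) : P4 g b0 b1 b2 b3 ((g 0).act y) = sgnR b0 • P4 g b0 b1 b2 b3 y := by
  simp only [P4, pstep_act_comm (hc 3 0), pstep_act_comm (hc 2 0), pstep_act_comm (hc 1 0),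
    pstep_act_self (hg 0) (sgnR_mul_self b0)]

/-- `P_b (g₁ y) = s₁ P_b y`. -/
theorem P4_act1 (y : ι → ℝ) : P4 g b0 b1 b2 b3 ((g 1).act y) = sgnR b1 • P4 g b0 b1 b2 b3 y := by
  simp only [P4, pstep_act_comm (hc 3 1), pstep_act_comm (hc 2 1),
    pstep_act_self (hg 1) (sgnR_mul_self b1), pstep_smul]

/-- `P_b (g₂ y) = s₂ P_b y`. -/
theorem P4_act2 (y : ι → ℝ) : P4 g b0 b1 b2 b3 ((g 2).act y) = sgnR b2 • P4 g b0 b1 b2 b3 y := by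
  simp only [P4, pstep_act_comm (hc 3 2), pstep_act_self (hg 2) (sgnR_mul_self b2), pstep_smul]

omit hc in
/-- `P_b (g₃ y) = s₃ P_b y`. -/
theorem P4_act3 (y : ι → ℝ) : P4 g b0 b1 b2 b3 ((g 3).act y) = sgnR b3 • P4 g b0 b1 b2 b3 y := by
  simp only [P4, pstep_act_self (hg 3) (sgnR_mul_self b3), pstep_smul]

omit hc in
/-- The steps are idempotent up to `2` on the image of `P_b`. -/
theorem pstep0_P4 (y : ι → ℝ) :
    pstep (g 0) (sgnR b0) (P4 g b0 b1 b2 b3 y) = (2 : ℝ) • P4 g b0 b1 b2 b3 y := by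
  simp only [P4]
  rw [pstep_pstep (hg 0) (sgnR_mul_self b0)]

/-- `(1 + s₁g₁) P_b = 2 P_b`. -/
theorem pstep1_P4 (y : ι → ℝ) :
    pstep (g 1) (sgnR b1) (P4 g b0 b1 b2 b3 y) = (2 : ℝ) • P4 g b0 b1 b2 b3 y := by
  simp only [P4]
  rw [pstep_comm (hc 1 0), pstep_pstep (hg 1) (sgnR_mul_self b1), pstep_smul]

/-- `(1 + s₂g₂) P_b = 2 P_b`. -/
theorem pstep2_P4 (y : ι → ℝ) :
    pstep (g 2) (sgnR b2) (P4 g b0 b1 b2 b3 y) = (2 : ℝ) • P4 g b0 b1 b2 b3 y := by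
  simp only [P4]
  rw [pstep_comm (hc 2 0), pstep_comm (hc 2 1), pstep_pstep (hg 2) (sgnR_mul_self b2), pstep_smul,
    pstep_smul]

/-- `(1 + s₃g₃) P_b = 2 P_b`. -/
theorem pstep3_P4 (y : ι → ℝ) :
    pstep (g 3) (sgnR b3) (P4 g b0 b1 b2 b3 y) = (2 : ℝ) • P4 g b0 b1 b2 b3 y := by
  simp only [P4]
  rw [pstep_comm (hc 3 0), pstep_comm (hc 3 1), pstep_comm (hc 3 2),
    pstep_pstep (hg 3) (sgnR_mul_self b3), pstep_smul, pstep_smul, pstep_smul]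

/-- `Q(P_b u, P_b v) = 16 Q(u, P_b v)`. -/
theorem zform_P4_left (hB : ∀ i, (g i).preserves B = true) (u v : ι → ℝ) :
    zform B (P4 g b0 b1 b2 b3 u) (P4 g b0 b1 b2 b3 v) = 16 * zform B u (P4 g b0 b1 b2 b3 v) := by
  have e0 := pstep0_P4 hg b0 b1 b2 b3 v
  have e1 := pstep1_P4 hg hc b0 b1 b2 b3 v
  have e2 := pstep2_P4 hg hc b0 b1 b2 b3 v
  have e3 := pstep3_P4 hg hc b0 b1 b2 b3 v
  show zform B (pstep (g 0) (sgnR b0) (pstep (g 1) (sgnR b1) (pstep (g 2) (sgnR b2)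
    (pstep (g 3) (sgnR b3) u)))) (P4 g b0 b1 b2 b3 v) = _
  rw [zform_pstep_left (hg 0) (hB 0), e0, LinearMap.map_smul, zform_pstep_left (hg 1) (hB 1), e1,
    LinearMap.map_smul, zform_pstep_left (hg 2) (hB 2), e2, LinearMap.map_smul,
    zform_pstep_left (hg 3) (hB 3), e3, LinearMap.map_smul]
  simp only [smul_eq_mul]
  ring

/-! ### Word images: `P_b e_{Pimg w t} = Pcoef_b w t • P_b e_t` -/

/-- `P_b` absorbs the optional letter `g₀`. -/
theorem P4_bact0 (w : Bool) (y : ι → ℝ) :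
    P4 g b0 b1 b2 b3 (bact (g 0) w y) = bsgn w (sgnR b0) • P4 g b0 b1 b2 b3 y := by
  cases w
  · simp only [bact, bsgn, cond_false, one_smul]
  · simp only [bact, bsgn, cond_true, P4_act0 hg hc]

/-- `P_b` absorbs the optional letter `g₁`. -/
theorem P4_bact1 (w : Bool) (y : ι → ℝ) :
    P4 g b0 b1 b2 b3 (bact (g 1) w y) = bsgn w (sgnR b1) • P4 g b0 b1 b2 b3 y := by
  cases w
  · simp only [bact, bsgn, cond_false, one_smul]
  · simp only [bact, bsgn, cond_true, P4_act1 hg hc]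

/-- `P_b` absorbs the optional letter `g₂`. -/
theorem P4_bact2 (w : Bool) (y : ι → ℝ) :
    P4 g b0 b1 b2 b3 (bact (g 2) w y) = bsgn w (sgnR b2) • P4 g b0 b1 b2 b3 y := by
  cases w
  · simp only [bact, bsgn, cond_false, one_smul]
  · simp only [bact, bsgn, cond_true, P4_act2 hg hc]

omit hc in
/-- `P_b` absorbs the optional letter `g₃`. -/
theorem P4_bact3 (w : Bool) (y : ι → ℝ) :
    P4 g b0 b1 b2 b3 (bact (g 3) w y) = bsgn w (sgnR b3) • P4 g b0 b1 b2 b3 y := by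
  cases w
  · simp only [bact, bsgn, cond_false, one_smul]
  · simp only [bact, bsgn, cond_true, P4_act3 hg]

omit hc in
/-- `bact g w (c • e_t) = (c · ccoef g 1 w t) • e_{cimg g w t}`. -/
theorem bact_single (i : Fin 4) (w : Bool) (c : ℝ) (t : ι) :
    bact (g i) w (c • Pi.single t (1 : ℝ)) =
      (c * (ccoef (g i) 1 w t : ℝ)) • Pi.single (cimg (g i) w t) (1 : ℝ) := by
  cases w
  · simp [bact, ccoef, cimg]
  · simp only [bact, ccoef, cimg, cond_true, act_single (hg i), one_mul]

/-- **Word images.** `P_b e_{Pimg w t} = Pcoef_b w t • P_b e_t`. -/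
theorem P4_single_img (w0 w1 w2 w3 : Bool) (t : ι) :
    P4 g b0 b1 b2 b3 (Pi.single (Pimg g w0 w1 w2 w3 t) 1) =
      ((Pcoef g b0 b1 b2 b3 w0 w1 w2 w3 t : ℤ) : ℝ) • P4 g b0 b1 b2 b3 (Pi.single t 1) := by
  -- the ε-part `E` and the sign part `S` of the coefficient
  set t3 := cimg (g 3) w3 t with ht3
  set t2 := cimg (g 2) w2 t3 with ht2
  set t1 := cimg (g 1) w1 t2 with ht1
  set E : ℤ := ccoef (g 3) 1 w3 t * ccoef (g 2) 1 w2 t3 * ccoef (g 1) 1 w1 t2 * ccoef (g 0) 1 w0 t1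
    with hE
  have hEE : (E : ℝ) * E = 1 := by
    have h1 : ∀ (i : Fin 4) (w : Bool) (u : ι), ccoef (g i) 1 w u * ccoef (g i) 1 w u = 1 := by
      intro i w u; cases w
      · simp [ccoef]
      · simp only [ccoef, cond_true, one_mul]; exact eps_sq (hg i) u
    have : E * E = 1 := by
      rw [hE]
      have a3 := h1 3 w3 t; have a2 := h1 2 w2 t3; have a1 := h1 1 w1 t2; have a0 := h1 0 w0 t1
      linear_combination (ccoef (g 2) 1 w2 t3 * ccoef (g 2) 1 w2 t3 * (ccoef (g 1) 1 w1 t2 *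
        ccoef (g 1) 1 w1 t2) * (ccoef (g 0) 1 w0 t1 * ccoef (g 0) 1 w0 t1)) * a3 +
        (ccoef (g 1) 1 w1 t2 * ccoef (g 1) 1 w1 t2 * (ccoef (g 0) 1 w0 t1 * ccoef (g 0) 1 w0 t1)) * a2 +
        (ccoef (g 0) 1 w0 t1 * ccoef (g 0) 1 w0 t1) * a1 + a0
    exact_mod_cast this
  -- the word action on `e_t`
  have hw : bact (g 0) w0 (bact (g 1) w1 (bact (g 2) w2 (bact (g 3) w3 (Pi.single t (1 : ℝ))))) =
      (E : ℝ) • Pi.single (Pimg g w0 w1 w2 w3 t) (1 : ℝ) := by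
    have e0 : (Pi.single t (1 : ℝ)) = (1 : ℝ) • Pi.single t (1 : ℝ) := (one_smul _ _).symm
    rw [e0, bact_single hg 3, bact_single hg 2, bact_single hg 1, bact_single hg 0]
    simp only [hE, Pimg, ← ht3, ← ht2, ← ht1, Int.cast_mul, one_mul]
  -- `P_b` of the word action
  have hP : P4 g b0 b1 b2 b3 (bact (g 0) w0 (bact (g 1) w1 (bact (g 2) w2
      (bact (g 3) w3 (Pi.single t (1 : ℝ)))))) =
      (bsgn w0 (sgnR b0) * bsgn w1 (sgnR b1) * bsgn w2 (sgnR b2) * bsgn w3 (sgnR b3)) •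
        P4 g b0 b1 b2 b3 (Pi.single t 1) := by
    rw [P4_bact0 hg hc, P4_bact1 hg hc, P4_bact2 hg hc, P4_bact3 hg, smul_smul, smul_smul,
      smul_smul]
  rw [hw, P4_smul] at hP
  -- `Pcoef = E · S`
  have hcoef : ((Pcoef g b0 b1 b2 b3 w0 w1 w2 w3 t : ℤ) : ℝ) =
      (E : ℝ) * (bsgn w0 (sgnR b0) * bsgn w1 (sgnR b1) * bsgn w2 (sgnR b2) * bsgn w3 (sgnR b3)) := by
    have hfac : ∀ (i : Fin 4) (b w : Bool) (u : ι),
        ((ccoef (g i) (sgnZ b) w u : ℤ) : ℝ) = (ccoef (g i) 1 w u : ℝ) * bsgn w (sgnR b) := by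
      intro i b w u; cases w
      · simp [ccoef, bsgn]
      · simp only [ccoef, bsgn, cond_true, one_mul, Int.cast_mul, sgnR_eq_cast]; ring
    simp only [Pcoef, hE, ← ht3, ← ht2, ← ht1, Int.cast_mul, hfac]
    ring
  calc P4 g b0 b1 b2 b3 (Pi.single (Pimg g w0 w1 w2 w3 t) 1)
      = ((E : ℝ) * E) • P4 g b0 b1 b2 b3 (Pi.single (Pimg g w0 w1 w2 w3 t) 1) := by
        rw [hEE, one_smul]
    _ = (E : ℝ) • ((bsgn w0 (sgnR b0) * bsgn w1 (sgnR b1) * bsgn w2 (sgnR b2) * bsgn w3 (sgnR b3)) •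
          P4 g b0 b1 b2 b3 (Pi.single t 1)) := by rw [mul_smul, hP]
    _ = ((Pcoef g b0 b1 b2 b3 w0 w1 w2 w3 t : ℤ) : ℝ) • P4 g b0 b1 b2 b3 (Pi.single t 1) := by
        rw [smul_smul, hcoef]

/-! ### The block theorem -/

/-- **Positivity of one symmetry block from a Gram certificate of its block matrix.**
`reps/ρ/word` present every index as a word image of an orbit representative (`hword`); for the sign
pattern `b`, `live` lists the orbits kept, and every other orbit carries a stabilising word of
coefficient `−1` (`hlive`), hence is annihilated by `P_b`. Then a passing `ddCheckP` of
`blockMat g B b (reps ∘ live)` proves `Q(P_b x, P_b x) ≥ 0` for all `x`. -/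
theorem block_nonneg (hB : ∀ i, (g i).preserves B = true) {n d : ℕ} (reps : Fin n → ι) (ρ : ι → Fin n)
    (word : ι → Bool × Bool × Bool × Bool)
    (hword : ∀ a, Pimg g (word a).1 (word a).2.1 (word a).2.2.1 (word a).2.2.2 (reps (ρ a)) = a)
    (live : Fin d → Fin n) (back : Fin n → Fin d) (kill : Fin n → Bool × Bool × Bool × Bool)
    (hlive : ∀ k, live (back k) = k ∨
      (Pimg g (kill k).1 (kill k).2.1 (kill k).2.2.1 (kill k).2.2.2 (reps k) = reps k ∧
        Pcoef g b0 b1 b2 b3 (kill k).1 (kill k).2.1 (kill k).2.2.1 (kill k).2.2.2 (reps k) = -1))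
    (G : Fin d → Fin d → ℤ) {σ : ℤ} (hσ : 0 < σ)
    (hchk : ddCheckP (blockMat g B b0 b1 b2 b3 (fun k' => reps (live k'))) G σ = true)
    (x : ι → ℝ) : 0 ≤ zform B (P4 g b0 b1 b2 b3 x) (P4 g b0 b1 b2 b3 x) := by
  -- notation
  set r' : Fin d → ι := fun k' => reps (live k') with hr'
  set c : ι → ℝ := fun a => if live (back (ρ a)) = ρ a then
    ((Pcoef g b0 b1 b2 b3 (word a).1 (word a).2.1 (word a).2.2.1 (word a).2.2.2 (reps (ρ a)) : ℤ) : ℝ)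
    else 0 with hc'
  -- (A) every basis vector maps to a multiple of its live representative's image
  have hA : ∀ a, P4 g b0 b1 b2 b3 (Pi.single a 1) =
      c a • P4 g b0 b1 b2 b3 (Pi.single (r' (back (ρ a))) 1) := by
    intro a
    have ha := P4_single_img hg hc b0 b1 b2 b3 (word a).1 (word a).2.1 (word a).2.2.1 (word a).2.2.2
      (reps (ρ a))
    rw [hword a] at ha
    by_cases h : live (back (ρ a)) = ρ a
    · have : c a = ((Pcoef g b0 b1 b2 b3 (word a).1 (word a).2.1 (word a).2.2.1 (word a).2.2.2
          (reps (ρ a)) : ℤ) : ℝ) := by rw [hc']; exact if_pos h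
      rw [this, ha, hr']
      simp only [h]
    · have hc0 : c a = 0 := by rw [hc']; exact if_neg h
      rcases hlive (ρ a) with h1 | ⟨h1, h2⟩
      · exact absurd h1 h
      · -- the representative is annihilated
        have hk := P4_single_img hg hc b0 b1 b2 b3 (kill (ρ a)).1 (kill (ρ a)).2.1 (kill (ρ a)).2.2.1
          (kill (ρ a)).2.2.2 (reps (ρ a))
        rw [h1, h2] at hk
        simp only [Int.reduceNeg, Int.cast_neg, Int.cast_one, neg_smul, one_smul] at hk
        have h2v : (2 : ℝ) • P4 g b0 b1 b2 b3 (Pi.single (reps (ρ a)) 1) = 0 := by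
          rw [two_smul]; nth_rewrite 1 [hk]; exact neg_add_cancel _
        have hv0 : P4 g b0 b1 b2 b3 (Pi.single (reps (ρ a)) 1) = 0 := by
          rcases smul_eq_zero.1 h2v with h3 | h3
          · norm_num at h3
          · exact h3
        rw [ha, hv0, smul_zero, hc0, zero_smul]
  -- (B) the block coordinates
  set z : Fin d → ℝ := fun k' => ∑ a ∈ univ.filter (fun a => back (ρ a) = k'), x a * c a with hz
  have hPx : P4 g b0 b1 b2 b3 x = ∑ k', z k' • P4 g b0 b1 b2 b3 (Pi.single (r' k') 1) := by
    have hx : x = ∑ a, x a • Pi.single a (1 : ℝ) := pi_eq_sum_univ' x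
    conv_lhs => rw [hx]
    rw [P4_sum]
    simp only [P4_smul]
    rw [← Finset.sum_fiberwise univ (fun a => back (ρ a))
      (fun a => x a • P4 g b0 b1 b2 b3 (Pi.single a 1))]
    refine Finset.sum_congr rfl fun k' _ => ?_
    rw [hz, Finset.sum_smul]
    refine Finset.sum_congr rfl fun a ha' => ?_
    rw [Finset.mem_filter] at ha'
    rw [hA a, smul_smul, ha'.2]
  -- (C) the value of the form in block coordinates
  have hQ : zform B (P4 g b0 b1 b2 b3 x) (P4 g b0 b1 b2 b3 x) =
      ∑ k, ∑ l, z k * (blockMat g B b0 b1 b2 b3 r' k l : ℝ) * z l := by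
    nth_rewrite 1 [hPx]
    rw [LinearMap.map_sum₂]
    refine Finset.sum_congr rfl fun k _ => ?_
    rw [LinearMap.map_smul₂, zform_P4_left hg hc b0 b1 b2 b3 hB, hPx]
    simp only [map_sum, map_smul, smul_eq_mul, Finset.mul_sum]
    refine Finset.sum_congr rfl fun l _ => ?_
    rw [blockMat_cast hg]
    ring
  rw [hQ]
  exact quadForm_nonneg_of_ddCheckP (blockMat g B b0 b1 b2 b3 r') G hσ hchk z

end Absorb

end SymmetryBlocks

end Summit.Ventures.CertifiedQuantumChemistry
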